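import Summits.AtomisticToContinuum.HydrodynamicLimit.Theorems.InfluenceLocality.Negative.TubeEnclosure
import HarnessLib

/-!
# `InfluenceLocality` (stmt-AtomisticToContinuum-13916) — torus distance from the chart (stub `stub_torusDistChart`)

Line `ignition-cascade-refutation` (lead c3), Phase 2 (construction of `IgnitionTemplates`). The cascade design
lives in the unit-cube chart of `𝕋³`; clearance between designed flight segments is certified in the chart
(Euclidean distance), and this file converts it into a minimal-image (torus) lower bound, uniformly across the
seam: if both chart points keep margin `m` from every face of the unit cube, then either the minimal image of
`proj P - proj Q` is the direct difference `P - Q`, or some coordinate is shifted by a nonzero integer `k i`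
(`|k i| ≥ 1`) which is compensated by at most `|P i - Q i| ≤ 1 - 2m`, leaving `≥ 2m`. Hence
`min ‖P - Q‖ (2m) ≤ euclidDist (proj P) (proj Q)`. Design-independent; asserts no Theses decl.
-/

namespace Summit.AtomisticToContinuum.HydrodynamicLimit.Theorems.InfluenceLocality.Negative

open MeasureTheory Set
open scoped InnerProductSpace
open Literature.Analysis.FluidPDE Literature.MathematicalPhysics.KineticTheory
open Literature.Analysis.FunctionSpaces

noncomputable section

/-- Each coordinate of the symmetric representative of `proj u` differs from that of `u` by an integer
(`proj_eq_proj_iff_holds` applied to `proj (reprSym (proj u)) = proj u`). -/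
theorem torusDistChart_exists_int_reprSym_proj (u : V3) :
    ∃ k : Fin 3 → ℤ, ∀ i, Torus.reprSym (Torus.proj u) i = u i + k i := by
  -- adapted from `exists_int_reprSym_proj` (AntiMazurCoboundariesCellForecastPressureDecayTorusReductionChart)
  obtain ⟨k, hk⟩ := (Literature.Analysis.FunctionSpaces.Torus.proj_eq_proj_iff_holds u
    (Torus.reprSym (Torus.proj u))).1 (Torus.proj_reprSym (Torus.proj u)).symm
  refine ⟨k, fun i => ?_⟩
  rw [hk]
  simp

/-- TORUS DISTANCE FROM THE CHART. If `P, Q ∈ [m, 1 - m]³` (margin `m` from every face of the unit cube), then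
the minimal-image distance of their projections to `𝕋³` is at least `min ‖P - Q‖ (2m)`: writing
`reprSym (proj (P - Q)) = (P - Q) + k` with `k ∈ ℤ³`, either `k = 0` (the minimal image is the chart difference),
or some `k i ≠ 0`, and then `|(P - Q) i + k i| ≥ |k i| - |P i - Q i| ≥ 1 - (1 - 2m) = 2m`, while a coordinate is
bounded by the Euclidean norm. -/
theorem stub_torusDistChart :
    ∀ (m : ℝ) (P Q : V3), (∀ i, m ≤ P i ∧ P i ≤ 1 - m) → (∀ i, m ≤ Q i ∧ Q i ≤ 1 - m) →
      min ‖P - Q‖ (2 * m) ≤ Torus.euclidDist (Torus.proj P) (Torus.proj Q) := by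
  intro m P Q hP hQ
  have hsub : Torus.proj P - Torus.proj Q = Torus.proj (P - Q) := by
    rw [sub_eq_add_neg, sub_eq_add_neg, Literature.Analysis.FunctionSpaces.Torus.proj_add,
      Literature.Analysis.FunctionSpaces.Torus.proj_neg]
  rw [Torus.euclidDist_eq, hsub]
  obtain ⟨k, hk⟩ := torusDistChart_exists_int_reprSym_proj (P - Q)
  by_cases h0 : ∀ i, k i = 0
  · -- no wrapping: the minimal image is the chart difference
    have heq : Torus.reprSym (Torus.proj (P - Q)) = P - Q := by
      ext i
      rw [hk i, h0 i]
      simp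
    rw [heq]
    exact min_le_left _ _
  · -- wrapping in coordinate `i`: the integer shift is compensated by at most `1 - 2m`
    obtain ⟨i, hi⟩ := not_forall.1 h0
    refine min_le_of_right_le ?_
    have h1 : (1 : ℝ) ≤ |(k i : ℝ)| := by
      rw [← Int.cast_abs]
      exact_mod_cast Int.one_le_abs hi
    have hPQ : |(P - Q) i| ≤ 1 - 2 * m := by
      rw [PiLp.sub_apply, abs_le]
      obtain ⟨hP1, hP2⟩ := hP i
      obtain ⟨hQ1, hQ2⟩ := hQ i
      constructor <;> linarith
    have h2 : 2 * m ≤ |Torus.reprSym (Torus.proj (P - Q)) i| := by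
      rw [hk i]
      have h3 := abs_sub_abs_le_abs_sub (k i : ℝ) (-((P - Q) i))
      rw [abs_neg, sub_neg_eq_add, add_comm] at h3
      linarith
    exact h2.trans (Torus.abs_reprSym_apply_le_norm _ i)

end

end Summit.AtomisticToContinuum.HydrodynamicLimit.Theorems.InfluenceLocality.Negative
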